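import Literature.AlgebraicGeometry.Pohlmann1968.NondegenerateCMTypeDivisorClasses
import HarnessLib

/-!
# Fibres of `Hom(K, ℂ) → Hom(k, ℂ)` along an embedding `e : k ↪ K` of an imaginary quadratic field into a sextic
# CM field: sizes, conjugation, and how a nondegenerate CM type meets them (multiplicities `(2, 1)`)

COR-CM (cell `pub-hodgecm2`, binder seat `b16` gen 37, count-neutral claim FOREIGN-IQ (F4a)); NEW as stated, hence under
`Summits/`.  Theorems only; no definition, no named fact, no `sorry`.  The elementary fibre combinatorics behind
Moonen–Zarhin's case (a) for `X = E × T` [MoonenZarhin1999LowDim, Thm. (0.2)]: `E` a CM elliptic curve with field `k`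
(`[k : ℚ] = 2`), `T` a simple CM threefold with field `K` (`[K : ℚ] = 6`) and `e : k ↪ K` — then `k` acts on the
tangent space of `T` with multiplicities `(2, 1)` or `(1, 2)`, never `(3, 0)` (the type would be induced from `k`).
Consumer: `CorCM/CMEllipticCurveTimesSimpleCMThreefoldWeilClass` (the Weil fibre weight on `E × T`).

* `eq_or_eq_conjugate_of_finrank_eq_two`, `comp_eq_or_eq_conjugate` — every `s : K → ℂ` restricts to `ψ` or `ψ̄`;
* `conjugate_comp`, `card_fibre_eq_card_fibre_conjugate`, **`card_fibre_eq_three`** — conjugation exchanges the two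
  fibres, each of size `[K : ℚ]/2 = 3`;
* `card_fibre_mem_add` — a CM type `Θ` of `K` meets the fibres of `ψ`, `ψ̄` in `n(ψ) + n(ψ̄) = 3` elements;
* **`card_fibre_mem_ne_three`** — a NONDEGENERATE `Θ` contains no whole fibre (it would then BE the fibre, and its
  translates would not separate two points of it: Kubota); **`exists_card_fibre_mem_eq_one`** — hence `n(ψ) = 1` for
  one of `ψ ∈ {ψ₀, ψ̄₀}`;
* `card_fibre_comp_mem_eq` — transport of the counts `#{s | s ∘ e = ψ, τ ∘ s ∈ Θ} = n(τ ∘ ψ)` by `τ ∈ Aut(ℂ)`.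

## References

* [MoonenZarhin1999LowDim] B. Moonen, Yu. Zarhin, Math. Ann. 315 (1999) 711–733, Thm. (0.2) (a), (1.9).
* [Shimura1998] G. Shimura, *Abelian Varieties with Complex Multiplication and Modular Functions*, §18.1.
* [Kubota1965] T. Kubota, Trans. AMS 118 (1965), §2 (p. 115).
-/

noncomputable section

open NumberField NumberField.ComplexEmbedding

namespace Summit.HodgeConjecture.CorCM

open Literature.NumberTheory.ComplexMultiplication
open Literature.AlgebraicGeometry.Motives (CMType)
open Literature.AlgebraicGeometry.Pohlmann1968

/-! ## §1 Fibres of `Hom(K, ℂ) → Hom(k, ℂ)` for a quadratic `k ↪ K` -/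

namespace WeilFibre

section Fibre

variable {k L : Type} [Field k] [NumberField k] [Field L] [NumberField L]

open scoped Classical in
/-- An imaginary quadratic field has exactly the two complex embeddings `ψ`, `ψ̄`. [cite: Shimura1998, §18.1] -/
theorem eq_or_eq_conjugate_of_finrank_eq_two (Ψ : CMType k) (h2 : Module.finrank ℚ k = 2) (ψ t : k →+* ℂ) :
    t = ψ ∨ t = conjugate ψ := by
  by_contra h
  push Not at h
  have hle : ({ψ, conjugate ψ, t} : Finset (k →+* ℂ)).card ≤ 2 := by
    rw [← h2, ← Embeddings.card k ℂ]
    exact Finset.card_le_univ _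
  rw [Finset.card_insert_of_notMem, Finset.card_pair (Ne.symm h.2)] at hle
  · omega
  · simp only [Finset.mem_insert, Finset.mem_singleton, not_or]
    exact ⟨(conjugate_ne_self Ψ ψ).symm, Ne.symm h.1⟩

omit [NumberField L] in
/-- Every `s : K → ℂ` restricts along `e : k → K` to `ψ` or to `ψ̄`. [cite: Shimura1998, §18.1] -/
theorem comp_eq_or_eq_conjugate (Ψ : CMType k) (h2 : Module.finrank ℚ k = 2) (e : k →+* L) (ψ : k →+* ℂ)
    (s : L →+* ℂ) : s.comp e = ψ ∨ s.comp e = conjugate ψ :=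
  eq_or_eq_conjugate_of_finrank_eq_two Ψ h2 ψ (s.comp e)

omit [NumberField k] [NumberField L] in
/-- Conjugation commutes with restriction: `s̄ ∘ e = \overline{s ∘ e}`. [folklore] -/
theorem conjugate_comp (e : k →+* L) (s : L →+* ℂ) : (conjugate s).comp e = conjugate (s.comp e) :=
  RingHom.ext fun x => by rw [RingHom.comp_apply, conjugate_coe_eq, conjugate_coe_eq, RingHom.comp_apply]

omit [NumberField k] in
open scoped Classical in
/-- Conjugation is a bijection from the fibre of `ψ` onto the fibre of `ψ̄`: equal sizes. [cite: Shimura1998, §18.1] -/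
theorem card_fibre_eq_card_fibre_conjugate (e : k →+* L) (ψ : k →+* ℂ) :
    (Finset.univ.filter fun s : L →+* ℂ => s.comp e = ψ).card =
      (Finset.univ.filter fun s : L →+* ℂ => s.comp e = conjugate ψ).card := by
  refine Finset.card_nbij' (fun s => conjugate s) (fun s => conjugate s) ?_ ?_ ?_ ?_
  · intro s hs
    simp only [Finset.mem_coe, Finset.mem_filter, Finset.mem_univ, true_and] at hs ⊢
    rw [conjugate_comp, hs]
  · intro s hs
    simp only [Finset.mem_coe, Finset.mem_filter, Finset.mem_univ, true_and] at hs ⊢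
    rw [conjugate_comp, hs]
    exact ComplexEmbedding.involutive_conjugate k ψ
  · intro s _
    exact ComplexEmbedding.involutive_conjugate L s
  · intro s _
    exact ComplexEmbedding.involutive_conjugate L s

open scoped Classical in
/-- **Each fibre of `Hom(K, ℂ) → Hom(k, ℂ)` has `[K : ℚ]/2` elements** (here `3` for a sextic `K`): the two fibres over
`ψ`, `ψ̄` partition `Hom(K, ℂ)` and are exchanged by conjugation. [cite: Shimura1998, §18.1] -/
theorem card_fibre_eq_three (Ψ : CMType k) (h2 : Module.finrank ℚ k = 2) (h6 : Module.finrank ℚ L = 6) (e : k →+* L)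
    (ψ : k →+* ℂ) : (Finset.univ.filter fun s : L →+* ℂ => s.comp e = ψ).card = 3 := by
  have hunion : (Finset.univ.filter fun s : L →+* ℂ => s.comp e = ψ) ∪
      (Finset.univ.filter fun s : L →+* ℂ => s.comp e = conjugate ψ) = Finset.univ := by
    ext s
    simp only [Finset.mem_union, Finset.mem_filter, Finset.mem_univ, true_and, iff_true]
    exact comp_eq_or_eq_conjugate Ψ h2 e ψ s
  have hdisj : Disjoint (Finset.univ.filter fun s : L →+* ℂ => s.comp e = ψ)
      (Finset.univ.filter fun s : L →+* ℂ => s.comp e = conjugate ψ) := by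
    rw [Finset.disjoint_filter]
    intro s _ h1 h2'
    exact conjugate_ne_self Ψ ψ (h2'.symm.trans h1)
  have hsum := Finset.card_union_of_disjoint hdisj
  rw [hunion, Finset.card_univ, Embeddings.card, h6, ← card_fibre_eq_card_fibre_conjugate e ψ] at hsum
  omega

open scoped Classical in
/-- `φ ↦ φ̄` maps the members of `Φ` over `ψ` bijectively onto the non-members over `ψ̄`:
`n(ψ) + n(ψ̄) = 3` where `n(ψ) = #{s ∈ Φ | s ∘ e = ψ}`. [cite: Shimura1998, §18.1] -/
theorem card_fibre_mem_add (Ψ : CMType k) (h2 : Module.finrank ℚ k = 2) (h6 : Module.finrank ℚ L = 6) (e : k →+* L)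
    (Θ : CMType L) (ψ : k →+* ℂ) :
    (Finset.univ.filter fun s : L →+* ℂ => s.comp e = ψ ∧ s ∈ Θ.1).card +
      (Finset.univ.filter fun s : L →+* ℂ => s.comp e = conjugate ψ ∧ s ∈ Θ.1).card = 3 := by
  -- `#{s | s∘e = ψ̄, s ∈ Θ} = #{s | s∘e = ψ, s ∉ Θ}` by conjugation
  have hbij : (Finset.univ.filter fun s : L →+* ℂ => s.comp e = conjugate ψ ∧ s ∈ Θ.1).card =
      (Finset.univ.filter fun s : L →+* ℂ => s.comp e = ψ ∧ s ∉ Θ.1).card := by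
    refine Finset.card_nbij' (fun s => conjugate s) (fun s => conjugate s) ?_ ?_ ?_ ?_
    · intro s hs
      simp only [Finset.mem_coe, Finset.mem_filter, Finset.mem_univ, true_and] at hs ⊢
      refine ⟨by rw [conjugate_comp, hs.1]; exact ComplexEmbedding.involutive_conjugate k ψ, fun h => ?_⟩
      exact ((Θ.2 s).1 hs.2) h
    · intro s hs
      simp only [Finset.mem_coe, Finset.mem_filter, Finset.mem_univ, true_and] at hs ⊢
      refine ⟨by rw [conjugate_comp, hs.1], ?_⟩
      by_contra h
      exact hs.2 ((Θ.2 s).2 h)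
    · intro s _
      exact ComplexEmbedding.involutive_conjugate L s
    · intro s _
      exact ComplexEmbedding.involutive_conjugate L s
  rw [hbij]
  have hsplit := Finset.card_filter_add_card_filter_not
    (s := Finset.univ.filter fun s : L →+* ℂ => s.comp e = ψ) (fun s : L →+* ℂ => s ∈ Θ.1)
  rw [Finset.filter_filter, Finset.filter_filter, card_fibre_eq_three Ψ h2 h6 e ψ] at hsplit
  exact hsplit

open scoped Classical in
/-- **A nondegenerate type does not contain a whole fibre** (`n(ψ) ≠ 3`): if `Θ ⊇ {s | s ∘ e = ψ}` then `Θ` IS that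
fibre (both have `3` elements), so for all `τ ∈ Aut(ℂ)` and `s, s'` in the fibre, `τs ∈ Θ ↔ τψ… ↔ τs' ∈ Θ`: the
translates of `Θ` do not separate `s ≠ s'`, contradicting Kubota's separation for nondegenerate types.
[cite: Kubota1965, §2 (p. 115)] [cite: MoonenZarhin1999LowDim, Thm. (0.2) (a)] -/
theorem card_fibre_mem_ne_three [IsCMField L] (Ψ : CMType k) (h2 : Module.finrank ℚ k = 2)
    (h6 : Module.finrank ℚ L = 6) (e : k →+* L) {Θ : CMType L} (hnd : IsNondegenerate Θ) (ψ : k →+* ℂ) :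
    (Finset.univ.filter fun s : L →+* ℂ => s.comp e = ψ ∧ s ∈ Θ.1).card ≠ 3 := by
  intro h3
  -- the fibre of `ψ` lies in `Θ`
  have hsub : ∀ s : L →+* ℂ, s.comp e = ψ → s ∈ Θ.1 := by
    intro s hs
    by_contra hns
    have hlt : (Finset.univ.filter fun s : L →+* ℂ => s.comp e = ψ ∧ s ∈ Θ.1).card <
        (Finset.univ.filter fun s : L →+* ℂ => s.comp e = ψ).card := by
      refine Finset.card_lt_card ⟨Finset.monotone_filter_right _ (fun t _ ht => ht.1), fun hle => hns ?_⟩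
      exact (Finset.mem_filter.1 (hle (Finset.mem_filter.2 ⟨Finset.mem_univ s, hs⟩))).2.2
    rw [h3, card_fibre_eq_three Ψ h2 h6 e ψ] at hlt
    exact lt_irrefl _ hlt
  -- hence the fibre of `ψ̄` misses `Θ`, and `Θ` is the fibre of `ψ`
  have hiff : ∀ s : L →+* ℂ, s ∈ Θ.1 ↔ s.comp e = ψ := by
    intro s
    refine ⟨fun hs => ?_, hsub s⟩
    rcases comp_eq_or_eq_conjugate Ψ h2 e ψ s with h | h
    · exact h
    · exfalso
      have hbar : (conjugate s).comp e = ψ := by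
        rw [conjugate_comp, h]; exact ComplexEmbedding.involutive_conjugate k ψ
      exact (Θ.2 s).1 hs (hsub _ hbar)
  -- two distinct points of the fibre are not separated by the translates of `Θ`
  obtain ⟨s, hs, s', hs', hss'⟩ : ∃ s ∈ (Finset.univ.filter fun s : L →+* ℂ => s.comp e = ψ),
      ∃ s' ∈ (Finset.univ.filter fun s : L →+* ℂ => s.comp e = ψ), s ≠ s' :=
    Finset.one_lt_card.1 (by rw [card_fibre_eq_three Ψ h2 h6 e ψ]; norm_num)
  simp only [Finset.mem_filter, Finset.mem_univ, true_and] at hs hs'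
  refine hss' (hnd.eq_of_forall_comp_mem_iff fun τ => ?_)
  rw [hiff, hiff, RingHom.comp_assoc, RingHom.comp_assoc, hs, hs']

open scoped Classical in
/-- **One of the two fibres meets a nondegenerate type in exactly one element**: `n(ψ₀) + n(ψ̄₀) = 3` with both `≠ 3`
(hence `≠ 0`), so `{n(ψ₀), n(ψ̄₀)} = {1, 2}` — the multiplicities `(2,1)` of `k` on the tangent space of `T`.
[cite: MoonenZarhin1999LowDim, Thm. (0.2) (a) and (1.9)] -/
theorem exists_card_fibre_mem_eq_one [IsCMField L] (Ψ : CMType k) (h2 : Module.finrank ℚ k = 2)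
    (h6 : Module.finrank ℚ L = 6) (e : k →+* L) {Θ : CMType L} (hnd : IsNondegenerate Θ) (ψ₀ : k →+* ℂ) :
    ∃ ψ : k →+* ℂ, (ψ = ψ₀ ∨ ψ = conjugate ψ₀) ∧
      (Finset.univ.filter fun s : L →+* ℂ => s.comp e = ψ ∧ s ∈ Θ.1).card = 1 := by
  have hsum := card_fibre_mem_add Ψ h2 h6 e Θ ψ₀
  have h0 := card_fibre_mem_ne_three Ψ h2 h6 e hnd ψ₀
  have h1 := card_fibre_mem_ne_three Ψ h2 h6 e hnd (conjugate ψ₀)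
  by_cases hone : (Finset.univ.filter fun s : L →+* ℂ => s.comp e = ψ₀ ∧ s ∈ Θ.1).card = 1
  · exact ⟨ψ₀, Or.inl rfl, hone⟩
  · exact ⟨conjugate ψ₀, Or.inr rfl, by omega⟩

open scoped Classical in
omit [NumberField k] in
/-- Transport of a fibre count by `τ ∈ Aut(ℂ)`: `#{s | s ∘ e = ψ, τ ∘ s ∈ Θ} = #{s' | s' ∘ e = τ ∘ ψ, s' ∈ Θ}`
(`s ↦ τ ∘ s` with inverse `s' ↦ τ⁻¹ ∘ s'`). [folklore] -/
theorem card_fibre_comp_mem_eq (e : k →+* L) (Θ : CMType L) (ψ : k →+* ℂ) (τ : ℂ ≃+* ℂ) :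
    (Finset.univ.filter fun s : L →+* ℂ => s.comp e = ψ ∧ (τ : ℂ →+* ℂ).comp s ∈ Θ.1).card =
      (Finset.univ.filter fun s : L →+* ℂ => s.comp e = (τ : ℂ →+* ℂ).comp ψ ∧ s ∈ Θ.1).card := by
  refine Finset.card_nbij' (fun s => (τ : ℂ →+* ℂ).comp s) (fun s => (τ.symm : ℂ →+* ℂ).comp s) ?_ ?_ ?_ ?_
  · intro s hs
    simp only [Finset.mem_coe, Finset.mem_filter, Finset.mem_univ, true_and] at hs ⊢
    exact ⟨by rw [RingHom.comp_assoc, hs.1], hs.2⟩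
  · intro s hs
    simp only [Finset.mem_coe, Finset.mem_filter, Finset.mem_univ, true_and] at hs ⊢
    have hcomp : (τ : ℂ →+* ℂ).comp ((τ.symm : ℂ →+* ℂ).comp s) = s :=
      RingHom.ext fun x => by simp
    refine ⟨?_, by rw [hcomp]; exact hs.2⟩
    rw [RingHom.comp_assoc, hs.1, ← RingHom.comp_assoc]
    refine RingHom.ext fun x => by simp
  · intro s _
    exact RingHom.ext fun x => by simp
  · intro s _
    exact RingHom.ext fun x => by simp

end Fibre

end WeilFibre

end Summit.HodgeConjecture.CorCM

end
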